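import Mathlib
import HarnessLib
import HarnessLib.Audit
import Literature.NumberTheory.LFunctions.ZetaLogDerivSeries
import Summits.RiemannHypothesis.RiemannHypothesis.Theorems.JensenPolynomialsDefs

/-!
# Jensen column (D-0040, ladder LADDER-RH rows J-P): the ZERO-SIDE rung «√d·log d range» — typed statements

RH-FREE PROOF-OF-DATA, like everything in `JensenPolynomialsDefs.lean`: statements about the explicit entire
function `G = xiSq` (`G(z) = ξ(½ + √z)`, `Literature.NumberTheory.LFunctions.xiSq`) and the explicit real numbers
`γ(n) = xiTaylorCoeff n`. WHAT THIS IS NOT: nothing here bears on the truth of RH; by the tree's barrier entries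
`Literature.Barriers.RiemannHypothesis.JensenPolynomials{,ShiftUniform,Sqrt,Cone}` (Farmer 2022) a hyperbolicity
RANGE `n ≥ N(d)` with `N(d) → ∞` carries no information about RH.

This file only NAMES objects and STATES claims (no proofs), so that the column's second rung route
(`Theses/JensenChainBand.lean`, theory seat rh-jensen-theory g9) can point at exact statements:

* §1 the rung leaf `JensenSqrtLogRangeTwenty` (J-P(P1″)): `J^{d,n}_γ` is hyperbolic whenever `n ≥ 20 000` and
  `20·√d·log n ≤ n` — i.e. `N(d) ≲ C·√d·log d`, against the cubic leaf `JensenCubicRangeTwo` (`n ≥ 2d³`, J-P(P1′)).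
* §2 the zero-side vocabulary of the EFFECTIVE KIM–LEE line (cell memo rh-jensen-idea-2 «negation lens», card
  `idea-effective-kim-lee`; Ki–Kim 2000 §2 backward Jensen chains + Gontcharoff's estimate at the anchor
  `G(0) = ξ(½) ≠ 0` + Cauchy at radius `e²·B` + the explicit order bound `‖ξ(s)‖ ≤ 8e⁶·exp(4‖s‖·log(1+‖s‖))`
  (`norm_riemannXi_le_of_half_le_re`)): the radius `chainRadius n = (n / log n)²/64` below which `G⁽ⁿ⁾` has no
  NON-REAL zero for `n ≥ 20 000` (`chainFloor`), the path length `chainPath` of a chain of zeros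
  `z₀, …, z_n` of `G, G′, …, G⁽ⁿ⁾` (`IsXiSqChain`), the explicit span bound `chainSpan n t` of a Jensen chain ending
  at a zero of modulus `≤ t`, the explicit growth majorant `xiGrowthBound r` of `‖G‖` on `‖z‖ ≤ r`, and the two
  generic shapes `XiDerivNonrealZeroBeyond R` (no non-real zero of `G⁽ⁿ⁾` below `R n`) and `JensenWideBandBelow R`
  (the hyperbolicity band it yields through the Kim–Lee genus-one sector theorem, tree
  `KimLee.splits_jensenPoly_taylor_of_zeros_mem_sector_two`).

References: [KiKim2000] H. Ki, Y.-O. Kim, Duke Math. J. 104 (2000) §2 (Lemma 2.1, (2.3), (2.5), Thm. 2.1);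
[KimLee2021] Y.-O. Kim, J. Lee, arXiv:2105.05386 = J. Korean Math. Soc. 59 (2022), Thm. 1, 2(ii), 4 (ineffective
`N(Ξ₀; d) = O(d^{1/2+ε})`); [GORZPNAS2019] Griffin–Ono–Rolen–Zagier, PNAS 116 (2019); [Farmer2022] Adv. Math. 411.
-/

noncomputable section
set_option linter.dupNamespace false

namespace Summit.RiemannHypothesis.RiemannHypothesis.Theorems.JensenPolynomials

open Literature.NumberTheory.LFunctions Polynomial Finset
open scoped BigOperators Nat

/-! ## 1. The rung leaf J-P(P1″) -/

/-- **RH-FREE. √d·log d range: `∀ n ≥ 20 000, ∀ d` with `20·√d·log n ≤ n`, `J^{d,n}_γ` is hyperbolic**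
(equivalently `400·d ≤ (n / log n)²`; so `N(d) ≤ C·√d·log d`, Kim–Lee 2021 Thm. 1 made effective and
log-sharp for `Ξ₀`). The cubic leaf `JensenCubicRangeTwo` (`n ≥ 2d³`) reaches `d ≤ (n/2)^{1/3} ≤ 27` at
`n = 40 000`; this leaf reaches `d ≤ (n / (20 log n))² = 35 603` there. Nowhere implied RH-freely by a tree theorem
(the tree's height-bought hyperbolicity is `d ≤ 64`, `jensenPoly_xiTaylorCoeff_splits_of_le`). -/
@[conjecture] def JensenSqrtLogRangeTwenty : Prop :=
  ∀ d n : ℕ, 20000 ≤ n → 20 * Real.sqrt d * Real.log n ≤ n → (jensenPoly xiTaylorCoeff d n).Splits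

/-! ## 2. Zero-side vocabulary (effective Kim–Lee by Jensen chains) -/

/-- Generic shape: every NON-REAL zero of `G⁽ⁿ⁾ = iteratedDeriv n xiSq` has modulus `≥ R n`. (Under RH it is
vacuous for every `R`: `G⁽ⁿ⁾` is then in the Laguerre–Pólya class; RH-free content depends on `R`.) -/
def XiDerivNonrealZeroBeyond (R : ℕ → ℝ) : Prop :=
  ∀ n : ℕ, ∀ z : ℂ, iteratedDeriv n xiSq z = 0 → z.im ≠ 0 → R n ≤ ‖z‖

/-- The WIDE hyperbolicity band below a radius function `R`: `J^{d,n}_γ` hyperbolic whenever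
`2d + (1 + √n)·√(2d) ≤ R n`. (`XiDerivNonrealZeroBeyond R → JensenWideBandBelow R` is kernel-checked in the
cell's HOME sketch `rh-jensen-idea-2/NegationLensSketch.lean`, `wideBand_of_beyond`, from the tree's Jensen
chains and the Kim–Lee genus-one sector theorem.) -/
def JensenWideBandBelow (R : ℕ → ℝ) : Prop :=
  ∀ d n : ℕ, 2 * (d : ℝ) + (1 + Real.sqrt n) * Real.sqrt (2 * d) ≤ R n →
    (jensenPoly xiTaylorCoeff d n).Splits

/-- The effective Kim–Lee radius `(n / log n)² / 64`. -/
def chainRadius (n : ℕ) : ℝ := ((n : ℝ) / Real.log n) ^ 2 / 64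

/-- The floor radius function of the rung: `chainRadius n` for `n ≥ 20 000`, no claim (`0`) below. -/
def chainFloor (n : ℕ) : ℝ := if 20000 ≤ n then chainRadius n else 0

/-- `z₀, …, z_n` is a CHAIN OF ZEROS of `G, G′, …, G⁽ⁿ⁾`: `G⁽ᵏ⁾(z_k) = 0` for `k ≤ n` (the Gontcharoff nodes;
a backward Jensen chain `exists_jensen_chain` is one). -/
def IsXiSqChain (n : ℕ) (z : ℕ → ℂ) : Prop :=
  ∀ k ≤ n, iteratedDeriv k xiSq (z k) = 0

/-- Path length of a chain seen from the anchor `0`: `‖z₀‖ + Σ_{k<n} ‖z_k − z_{k+1}‖` (the quantity in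
Gontcharoff's estimate `gontcharoff_norm_le` at `w = 0`). -/
def chainPath (n : ℕ) (z : ℕ → ℂ) : ℝ :=
  ‖z 0‖ + ∑ k ∈ Finset.range n, ‖z k - z (k + 1)‖

/-- Explicit span bound of a backward Jensen chain of length `n` ending at a zero of modulus `≤ t`:
`(1 + √n + √t)·(2(1 + √n) + √t)` (from variation `≤ Im z₀·(1+√n)`, `Im z₀ ≤ √‖z₀‖`, `‖z₀‖ ≤ t + variation`). -/
def chainSpan (n : ℕ) (t : ℝ) : ℝ :=
  (1 + Real.sqrt n + Real.sqrt t) * (2 * (1 + Real.sqrt n) + Real.sqrt t)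

/-- Explicit majorant of `‖G‖` on the disc `‖z‖ ≤ r`: `8e⁶·exp(4(½ + √r)·log(3/2 + √r))`
(`‖ξ(s)‖ ≤ 8e⁶ exp(4‖s‖ log(1+‖s‖))` for `re s ≥ ½`, `s = ½ + √z` on the principal branch, `‖s‖ ≤ ½ + √r`). -/
def xiGrowthBound (r : ℝ) : ℝ :=
  8 * Real.exp 6 * Real.exp (4 * (1 / 2 + Real.sqrt r) * Real.log (3 / 2 + Real.sqrt r))

/-! ## 3. Sanity (definitional unfoldings used by the route's glue) -/

/-- Unfolding: for `n ≥ 20 000` the floor radius is `chainRadius n`. -/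
theorem chainFloor_of_le {n : ℕ} (h : 20000 ≤ n) : chainFloor n = chainRadius n := if_pos h

/-- Unfolding: below `n = 20 000` the floor radius makes no claim (`0`). -/
theorem chainFloor_of_lt {n : ℕ} (h : n < 20000) : chainFloor n = 0 := if_neg (Nat.not_le.2 h)

/-- The path length of a chain is nonnegative. -/
theorem chainPath_nonneg (n : ℕ) (z : ℕ → ℂ) : 0 ≤ chainPath n z :=
  add_nonneg (norm_nonneg _) (Finset.sum_nonneg fun _ _ => norm_nonneg _)

/-- The growth majorant `xiGrowthBound r` is positive. -/
theorem xiGrowthBound_pos (r : ℝ) : 0 < xiGrowthBound r := by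
  unfold xiGrowthBound; positivity

end Summit.RiemannHypothesis.RiemannHypothesis.Theorems.JensenPolynomials
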